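import Literature.MathematicalPhysics.QuantumFieldTheory.AbelianContourGas
import Literature.Probability.LatticeModels.ClusterExpansionKPBound
import Literature.Probability.LatticeModels.PolymerPressure
import HarnessLib

/-!
# The cluster expansion of the contour gas: exponential clustering of multiplicative local observables

Support file for the low-temperature expansion of `ℤ_n` lattice gauge theory on the tori
`(ℤ/Lℤ)^d` (discharge of `Literature.Barriers.QuantumFields.ZnHiggsPhaseD4` through the torus core
facts of `DiscreteSubgroupFreezingProofs.lean`). On top of the polymer representation
`AbelianContourGas.sum_closed_eq_polymerPartitionFunction` of the closed-configuration sums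
`Z(ψ) = ∑_{η closed} Wt(η) ψ(η)` and of the Kotecký–Preiss condition `AbelianContourGas.kp_act`,
this file runs the Kotecký–Preiss cluster expansion of the tree
(`Literature.Probability.LatticeModels.ClusterExpansion`, with the estimate (4) of [KP86] proved
in `ClusterExpansionKPBound`) for the hard-core gas of cube-connected vortices:

* in the **Kotecký–Preiss regime** `KPRegime` (single-plaquette weights `φ ≤ ε` off `0` with
  `(Δ+1)² |A| ε e^{1+τ} ≤ 1/2`, `Δ = cubeDeg d`) every dressed activity system `act φ ψ`,
  `|ψ| ≤ 1`, satisfies the KP condition with `a(X) = #X`, `d(X) = τ #X` (`KPRegime.kp_hyp`,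
  `KPRegime.isKPVolume`), so `Z(ψ) = Ξ(act φ ψ) = exp (∑_C Φ^T(C; act φ ψ))`
  (`KPRegime.Z_eq_exp_sum_truncatedWeight`);
* for a multiplicative observable `ψ` which is *local on* a plaquette set `B` (`ψ(η) = 1` unless
  the support of `η` meets `B`), the dressed and undressed activities agree on polymers disjoint
  from `B` (`truncatedWeight_eq_of_not_meets`), hence
  `Z(ψ)/Z(1) = exp (∑_{C meets B} [Φ^T(C; act φ ψ) - Φ^T(C; act φ 1)])` (inside the proof of
  `KPRegime.norm_closedCov_le`), and `∑_{C meets B} |Φ^T(C; ·)| ≤ #B` (`KPRegime.sum_meets_norm_le`);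
* **the covariance of two multiplicative local observables** `ψ₁` (on `B₁`), `ψ₂` (on `B₂`):
  `Z(ψ₁ψ₂)/Z(1) - Z(ψ₁)/Z(1) · Z(ψ₂)/Z(1) = e^{A₁+A₂} (e^{R₁₂} - e^{R₁+R₂})`, where only the
  clusters meeting both `B₁` and `B₂` enter the `R`-terms; if every such cluster has total size
  `≥ D`, the `d`-weighted form of (4) gives `|R| ≤ 2 #B₁ e^{-τ D}` and the bound
  `‖Cov‖ ≤ 6 #B₁ e^{6 #B₁ + 2 #B₂} e^{-τ D}` (`KPRegime.norm_closedCov_le`). The geometric input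
  (a cluster meeting two plaquette sets far apart along some axis is large, because its support
  is cube-connected) is `le_sum_card_of_cluster_meets` (discrete intermediate value theorem for
  the circular coordinate distance `torusLevel`).

This is the exponential clustering of the Higgs (low-temperature) phase for the closed-vortex
ensemble (Marra–Miracle-Solé 1979 for `ℤ₂`; Forsström 2022 Thm. 1 for finite abelian groups);
the passage to link configurations and to general local observables is done in the sequel.

## References

* R. Kotecký, D. Preiss, Comm. Math. Phys. 103 (1986) 491–498, Theorem and (4), (5).
  [KoteckyPreiss1986]
* R. Marra, S. Miracle-Solé, Comm. Math. Phys. 67 (1979) 233–240 (cluster expansion and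
  exponential clustering of the gauge invariant Ising model at low temperature). [MarraMiraclesole1979]
* M. P. Forsström, Comm. Math. Phys. 393 (2022) 1311–1346, Thm. 1. [Forsstrom2022]
* S. Friedli, Y. Velenik, *Statistical Mechanics of Lattice Systems* (2017), §5.4–§5.7.
  [FriedliVelenik2017]
-/

noncomputable section

open Finset Function
open Literature.Probability.LatticeModels (IsRConnected Touches GeomInc rcomponent rcomponents
  polymerPartitionFunction IsCompatible kpTerm KPTouches IsKPVolume IsPolymerCluster polymerLogZ
  truncatedWeight koteckyPreiss_truncatedWeight_bound clusterSupp)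

namespace Literature.MathematicalPhysics.QuantumFieldTheory

namespace LatticeForm

variable {d L : ℕ} [NeZero L] {A : Type*} [AddCommGroup A] [Fintype A] [DecidableEq A]

/-! ### The incompatibility relation of the contour gas -/

/-- The geometric incompatibility of cube-connected plaquette sets is reflexive. [folklore] -/
instance instReflGeomIncCubeAdj : Std.Refl (GeomInc (CubeAdj (d := d) (L := L))) :=
  ⟨fun _ => Or.inl rfl⟩

/-- The geometric incompatibility of cube-connected plaquette sets is symmetric. [folklore] -/
instance instSymmGeomIncCubeAdj : Std.Symm (GeomInc (CubeAdj (d := d) (L := L))) :=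
  ⟨fun _ _ h => Literature.Probability.LatticeModels.geomInc_symm _ (fun _ _ => cubeAdj_symm) h⟩

/-- A family of polymers *meets* a plaquette set `B`: some member intersects `B`. [folklore] -/
def Meets (C : Finset (Finset (Plaquette d L))) (B : Finset (Plaquette d L)) : Prop :=
  ∃ X ∈ C, (X ∩ B).Nonempty

omit [NeZero L] in
/-- A family meeting `B` touches the polymer `B` in the sense of [KP86]. [folklore] -/
theorem kpTouches_of_meets {C : Finset (Finset (Plaquette d L))} {B : Finset (Plaquette d L)}
    (h : Meets C B) : KPTouches (GeomInc CubeAdj) C B := by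
  obtain ⟨X, hX, q, hq⟩ := h
  rw [Finset.mem_inter] at hq
  exact ⟨X, hX, Or.inr ⟨q, hq.1, q, hq.2, Or.inl rfl⟩⟩

/-! ### The Kotecký–Preiss regime -/

/-- The KP size function `a(X) = #X`. [cite: KoteckyPreiss1986, (1)] -/
def kpa (X : Finset (Plaquette d L)) : ℝ := X.card

/-- The KP decay function `d(X) = τ #X`. [cite: KoteckyPreiss1986, (1)] -/
def kpd (τ : ℝ) (X : Finset (Plaquette d L)) : ℝ := τ * X.card

/-- **The Kotecký–Preiss regime of the contour gas**: single-plaquette weights `φ` with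
`φ 0 = 1`, `0 ≤ φ ≤ ε` off `0`, a decay parameter `τ ≥ 0`, and the smallness condition
`(Δ+1)² |A| ε e^{1+τ} ≤ 1/2` (`Δ = cubeDeg d`) under which `kp_act` gives the KP condition for
every dressed activity system. [cite: KoteckyPreiss1986, (1) (the convergence condition)] -/
structure KPRegime (d : ℕ) (A : Type*) [Fintype A] [Zero A] (φ : A → ℝ) (ε τ : ℝ) : Prop where
  zero : φ 0 = 1
  nonneg : ∀ a, 0 ≤ φ a
  eps_nonneg : 0 ≤ ε
  le_eps : ∀ a, a ≠ 0 → φ a ≤ ε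
  tau_nonneg : 0 ≤ τ
  small : ((cubeDeg d : ℝ) + 1) ^ 2 * ((Fintype.card A : ℝ) * ε * Real.exp (1 + τ)) ≤ 1 / 2

namespace KPRegime

variable {φ : A → ℝ} {ε τ : ℝ}

/-- The KP hypothesis (1) of [KP86] for the dressed activities, in the summable form consumed by
`koteckyPreiss_truncatedWeight_bound`. [cite: KoteckyPreiss1986, (1)] -/
theorem kp_hyp (h : KPRegime d A φ ε τ) {ψ : (Plaquette d L → A) → ℂ} (hψ : ∀ η, ‖ψ η‖ ≤ 1)
    (γ : Finset (Plaquette d L)) :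
    Summable (fun γ' : {γ' : Finset (Plaquette d L) // GeomInc CubeAdj γ' γ} =>
        ‖act φ ψ (γ' : Finset (Plaquette d L))‖ *
          Real.exp (kpa (γ' : Finset (Plaquette d L)) + kpd τ (γ' : Finset (Plaquette d L)))) ∧
      ∑' γ' : {γ' : Finset (Plaquette d L) // GeomInc CubeAdj γ' γ},
        ‖act φ ψ (γ' : Finset (Plaquette d L))‖ *
          Real.exp (kpa (γ' : Finset (Plaquette d L)) + kpd τ (γ' : Finset (Plaquette d L))) ≤ kpa γ := by
  refine Literature.Probability.LatticeModels.kp_hypothesis_of_fintype (inc := GeomInc CubeAdj)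
    (fun W => ?_) γ
  simpa [kpa, kpd] using kp_act h.zero h.nonneg h.eps_nonneg h.le_eps hψ h.small W

/-- The finite-volume KP condition on the family of connected plaquette sets. [cite: KoteckyPreiss1986, (1)] -/
theorem isKPVolume (h : KPRegime d A φ ε τ) {ψ : (Plaquette d L → A) → ℂ} (hψ : ∀ η, ‖ψ η‖ ≤ 1) :
    IsKPVolume (GeomInc CubeAdj) (act φ ψ) kpa (connSets d L) := by
  classical
  intro γ _
  have key := kp_act h.zero h.nonneg h.eps_nonneg h.le_eps hψ h.small γ
  calc ∑ γ' ∈ (connSets d L) with GeomInc CubeAdj γ' γ, kpTerm (act φ ψ) kpa γ'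
      ≤ ∑ γ' ∈ (Finset.univ : Finset (Finset (Plaquette d L))).filter (fun Y => GeomInc CubeAdj Y γ),
          kpTerm (act φ ψ) kpa γ' :=
        Finset.sum_le_sum_of_subset_of_nonneg (Finset.filter_subset_filter _ (Finset.subset_univ _))
          fun γ' _ _ => Literature.Probability.LatticeModels.kpTerm_nonneg _ _ _
    _ ≤ ∑ γ' ∈ (Finset.univ : Finset (Finset (Plaquette d L))).filter (fun Y => GeomInc CubeAdj Y γ),
          ‖act φ ψ γ'‖ * Real.exp ((γ'.card : ℝ) + τ * γ'.card) := Finset.sum_le_sum fun γ' _ => by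
        unfold kpTerm kpa
        refine mul_le_mul_of_nonneg_left (Real.exp_le_exp.2 ?_) (norm_nonneg _)
        have := h.tau_nonneg
        nlinarith [Nat.cast_nonneg (α := ℝ) γ'.card]
    _ ≤ γ.card := key

/-- The KP estimate (4) is available for every dressed activity system in the regime. [cite: KoteckyPreiss1986, Theorem p. 492, estimate (4)] -/
theorem kp_fact (φ : A → ℝ) (ψ : (Plaquette d L → A) → ℂ) (τ : ℝ) :
    koteckyPreiss_truncatedWeight_bound (GeomInc CubeAdj) (act φ ψ)
      (kpa (d := d) (L := L)) (kpd τ) :=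
  Literature.Probability.LatticeModels.koteckyPreiss_truncatedWeight_bound_holds _ _ _ _

omit [NeZero L] [Fintype A] [DecidableEq A] in
/-- `a ≥ 0`. [folklore] -/
theorem kpa_nonneg (γ : Finset (Plaquette d L)) : 0 ≤ kpa (d := d) (L := L) γ := Nat.cast_nonneg _

omit [NeZero L] [Fintype A] [DecidableEq A] in
/-- `d ≥ 0` for `τ ≥ 0`. [folklore] -/
theorem kpd_nonneg (hτ : 0 ≤ τ) (γ : Finset (Plaquette d L)) : 0 ≤ kpd (d := d) (L := L) τ γ :=
  mul_nonneg hτ (Nat.cast_nonneg _)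

end KPRegime

variable {φ : A → ℝ}

/-! ### The closed-configuration sums as polymer partition functions -/

/-- The closed-configuration sum dressed by `ψ`: `Z(ψ) = ∑_{η closed} Wt(η) ψ(η)`. [folklore] -/
def Zobs (φ : A → ℝ) (ψ : (Plaquette d L → A) → ℂ) : ℂ := ∑ η ∈ Closed d L A, (Wt φ η : ℂ) * ψ η

/-- In the KP regime, `Z(ψ) = exp (∑_{C ⊆ Λ} Φ^T(C; act φ ψ))` for multiplicative `ψ` with
`|ψ| ≤ 1` (polymer representation, the Kotecký–Preiss logarithm and the expansion (2)).
[cite: KoteckyPreiss1986, Theorem p. 492 with (2)] -/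
theorem KPRegime.Z_eq_exp_sum_truncatedWeight {φ : A → ℝ} {ε τ : ℝ} (h : KPRegime d A φ ε τ)
    {ψ : (Plaquette d L → A) → ℂ}
    (hmult : IsMultObs ψ) (hψ : ∀ η, ‖ψ η‖ ≤ 1) :
    Zobs φ ψ = Complex.exp (∑ C ∈ (connSets d L).powerset, truncatedWeight (GeomInc CubeAdj) (act φ ψ) C) := by
  rw [Zobs, sum_closed_eq_polymerPartitionFunction h.zero hmult,
    ← Literature.Probability.LatticeModels.polymerLogZ_eq_sum_truncatedWeight,
    Literature.Probability.LatticeModels.exp_polymerLogZ_of_kp (h.isKPVolume hψ) le_rfl]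

/-! ### Local observables and the dressed activities -/

/-- `ψ` is *local on* the plaquette set `B`: it equals `1` on every configuration whose support
does not meet `B`. [folklore] -/
def IsLocalOn (ψ : (Plaquette d L → A) → ℂ) (B : Finset (Plaquette d L)) : Prop :=
  ∀ η, Disjoint (psupp η) B → ψ η = 1

/-- The dressed activity of a polymer disjoint from `B` is the undressed one. [folklore] -/
theorem act_eq_act_one_of_disjoint {ψ : (Plaquette d L → A) → ℂ} {B : Finset (Plaquette d L)}
    (hloc : IsLocalOn ψ B) {X : Finset (Plaquette d L)} (hX : Disjoint X B) :
    act φ ψ X = act φ (fun _ => 1) X := by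
  classical
  unfold act
  split_ifs with hc
  · refine Finset.sum_congr rfl fun η hη => ?_
    rw [hloc η (by rw [(mem_Fib.1 hη).2]; exact hX)]
  · rfl

/-- More generally, dressing by a product `ψ₁ ψ₂` with `ψ₂` local on `B₂` agrees with dressing by
`ψ₁` on polymers disjoint from `B₂`. [folklore] -/
theorem act_mul_eq_act_of_disjoint {ψ₁ ψ₂ : (Plaquette d L → A) → ℂ} {B₂ : Finset (Plaquette d L)}
    (hloc : IsLocalOn ψ₂ B₂) {X : Finset (Plaquette d L)} (hX : Disjoint X B₂) :
    act φ (fun η => ψ₁ η * ψ₂ η) X = act φ ψ₁ X := by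
  classical
  unfold act
  split_ifs with hc
  · refine Finset.sum_congr rfl fun η hη => ?_
    show (Wt φ η : ℂ) * (ψ₁ η * ψ₂ η) = (Wt φ η : ℂ) * ψ₁ η
    rw [hloc η (by rw [(mem_Fib.1 hη).2]; exact hX), mul_one]
  · rfl

omit [Fintype A] in
/-- The constant observable `1` is multiplicative. [folklore] -/
theorem isMultObs_one : IsMultObs (fun _ : Plaquette d L → A => (1 : ℂ)) := ⟨rfl, fun _ _ _ => by simp⟩

omit [Fintype A] in
/-- Products of multiplicative observables are multiplicative. [folklore] -/
theorem IsMultObs.mul {ψ₁ ψ₂ : (Plaquette d L → A) → ℂ} (h₁ : IsMultObs ψ₁) (h₂ : IsMultObs ψ₂) :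
    IsMultObs fun η => ψ₁ η * ψ₂ η := by
  refine ⟨?_, fun η₁ η₂ hdis => ?_⟩
  · show ψ₁ 0 * ψ₂ 0 = 1
    rw [h₁.1, h₂.1, mul_one]
  · show ψ₁ (η₁ + η₂) * ψ₂ (η₁ + η₂) = (ψ₁ η₁ * ψ₂ η₁) * (ψ₁ η₂ * ψ₂ η₂)
    rw [h₁.2 η₁ η₂ hdis, h₂.2 η₁ η₂ hdis]; ring

omit [Fintype A] in
/-- Products of local observables are local on the union. [folklore] -/
theorem IsLocalOn.mul {ψ₁ ψ₂ : (Plaquette d L → A) → ℂ} {B₁ B₂ : Finset (Plaquette d L)}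
    (h₁ : IsLocalOn ψ₁ B₁) (h₂ : IsLocalOn ψ₂ B₂) : IsLocalOn (fun η => ψ₁ η * ψ₂ η) (B₁ ∪ B₂) := by
  intro η hη
  rw [Finset.disjoint_union_right] at hη
  show ψ₁ η * ψ₂ η = 1
  rw [h₁ η hη.1, h₂ η hη.2, mul_one]

/-- The truncated functional of a family of polymers none of which meets `B` does not see the
dressing by an observable local on `B`. [folklore] -/
theorem truncatedWeight_eq_of_not_meets {ψ : (Plaquette d L → A) → ℂ} {B : Finset (Plaquette d L)}
    (hloc : IsLocalOn ψ B) {C : Finset (Finset (Plaquette d L))} (hC : ¬ Meets C B) :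
    truncatedWeight (GeomInc CubeAdj) (act φ ψ) C = truncatedWeight (GeomInc CubeAdj) (act φ fun _ => 1) C := by
  refine Literature.Probability.LatticeModels.truncatedWeight_congr fun X hX => ?_
  refine act_eq_act_one_of_disjoint hloc (Finset.disjoint_iff_inter_eq_empty.2 ?_)
  by_contra hne
  exact hC ⟨X, hX, Finset.nonempty_iff_ne_empty.2 hne⟩

/-- Likewise for a product dressing. [folklore] -/
theorem truncatedWeight_mul_eq_of_not_meets {ψ₁ ψ₂ : (Plaquette d L → A) → ℂ}
    {B₂ : Finset (Plaquette d L)} (hloc : IsLocalOn ψ₂ B₂) {C : Finset (Finset (Plaquette d L))}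
    (hC : ¬ Meets C B₂) :
    truncatedWeight (GeomInc CubeAdj) (act φ fun η => ψ₁ η * ψ₂ η) C =
      truncatedWeight (GeomInc CubeAdj) (act φ ψ₁) C := by
  refine Literature.Probability.LatticeModels.truncatedWeight_congr fun X hX => ?_
  refine act_mul_eq_act_of_disjoint hloc (Finset.disjoint_iff_inter_eq_empty.2 ?_)
  by_contra hne
  exact hC ⟨X, hX, Finset.nonempty_iff_ne_empty.2 hne⟩

/-! ### Cluster sums: the KP estimate (4) at work -/

/-- The difference of dressed and undressed truncated functionals. [folklore] -/
def dPhi (φ : A → ℝ) (ψ : (Plaquette d L → A) → ℂ) (C : Finset (Finset (Plaquette d L))) : ℂ :=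
  truncatedWeight (GeomInc CubeAdj) (act φ ψ) C - truncatedWeight (GeomInc CubeAdj) (act φ fun _ => 1) C

/-- Norms of cluster sums of activity differences: `‖∑_{𝒞} dPhi‖ ≤ ∑ ‖Φ^T(act ψ)‖ + ∑ ‖Φ^T(act 1)‖`.
[folklore] -/
theorem norm_dPhi_le (φ : A → ℝ) (ψ : (Plaquette d L → A) → ℂ) (C : Finset (Finset (Plaquette d L))) :
    ‖dPhi φ ψ C‖ ≤ ‖truncatedWeight (GeomInc CubeAdj) (act φ ψ) C‖ +
        ‖truncatedWeight (GeomInc CubeAdj) (act φ fun _ => 1) C‖ :=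
  norm_sub_le _ _

/-- `‖e^z - 1‖ ≤ ‖z‖ e^{‖z‖}`. [folklore] -/
theorem norm_exp_sub_one_le_mul_exp (z : ℂ) : ‖Complex.exp z - 1‖ ≤ ‖z‖ * Real.exp ‖z‖ := by
  have h := Complex.norm_exp_sub_sum_le_norm_mul_exp z 1
  simpa using h

/-- Norm of an indicator-weighted sum. [folklore] -/
theorem norm_sum_ite_le {ι : Type*} (s : Finset ι) (p : ι → Prop) [DecidablePred p] (f : ι → ℂ) :
    ‖∑ i ∈ s, (if p i then f i else 0)‖ ≤ ∑ i ∈ s, (if p i then ‖f i‖ else 0) := by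
  refine (norm_sum_le _ _).trans (Finset.sum_le_sum fun i _ => ?_)
  split_ifs <;> simp

namespace KPRegime

variable {φ : A → ℝ} {ε τ : ℝ}

/-- **Clusters meeting `B` have total truncated weight at most `#B`** (estimate (4) at the polymer
`σ = B`, via `kpTouches_of_meets`). [cite: KoteckyPreiss1986, Theorem p. 492, estimate (4)] -/
theorem sum_meets_norm_le (h : KPRegime d A φ ε τ) {ψ : (Plaquette d L → A) → ℂ} (hψ : ∀ η, ‖ψ η‖ ≤ 1)
    (𝒞 : Finset (Finset (Finset (Plaquette d L)))) (B : Finset (Plaquette d L))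
    [DecidablePred fun C : Finset (Finset (Plaquette d L)) => Meets C B] :
    ∑ C ∈ 𝒞.filter (fun C => Meets C B), ‖truncatedWeight (GeomInc CubeAdj) (act φ ψ) C‖ ≤ B.card := by
  classical
  calc ∑ C ∈ 𝒞.filter (fun C => Meets C B), ‖truncatedWeight (GeomInc CubeAdj) (act φ ψ) C‖
      ≤ ∑ C ∈ 𝒞 with KPTouches (GeomInc CubeAdj) C B, ‖truncatedWeight (GeomInc CubeAdj) (act φ ψ) C‖ :=
        Finset.sum_le_sum_of_subset_of_nonneg (fun C hC => by
          rw [Finset.mem_filter] at hC ⊢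
          exact ⟨hC.1, kpTouches_of_meets hC.2⟩) fun _ _ _ => norm_nonneg _
    _ ≤ kpa B := Literature.Probability.LatticeModels.sum_norm_truncatedWeight_le_of_touches
        (kp_fact φ ψ τ) kpa_nonneg (kpd_nonneg h.tau_nonneg) (h.kp_hyp hψ) 𝒞 B

/-- **Far clusters are exponentially small**: if every family in `𝒞` which touches the polymer
`B₁` has total size `∑_{X ∈ C} #X ≥ D`, then their total truncated weight is at most
`e^{-τ D} #B₁` (estimate (4) with the decay function `d = τ #·`). [cite: KoteckyPreiss1986, Theorem p. 492, estimate (4)] -/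
theorem sum_touches_norm_le_exp_neg (h : KPRegime d A φ ε τ) {ψ : (Plaquette d L → A) → ℂ}
    (hψ : ∀ η, ‖ψ η‖ ≤ 1) (𝒞 : Finset (Finset (Finset (Plaquette d L)))) (B₁ : Finset (Plaquette d L))
    {D : ℝ} (hD : ∀ C ∈ 𝒞, KPTouches (GeomInc CubeAdj) C B₁ → D ≤ ∑ X ∈ C, (X.card : ℝ))
    [DecidablePred fun C : Finset (Finset (Plaquette d L)) => KPTouches (GeomInc CubeAdj) C B₁] :
    ∑ C ∈ 𝒞.filter (fun C => KPTouches (GeomInc CubeAdj) C B₁),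
        ‖truncatedWeight (GeomInc CubeAdj) (act φ ψ) C‖ ≤ Real.exp (-(τ * D)) * B₁.card := by
  have := Literature.Probability.LatticeModels.sum_norm_truncatedWeight_le_exp_neg_of_touches
    (kp_fact φ ψ τ) kpa_nonneg (kpd_nonneg h.tau_nonneg) (h.kp_hyp hψ) 𝒞 B₁ (r := τ * D)
    (fun C hC ht => by
      have := hD C hC ht
      unfold kpd
      rw [← Finset.mul_sum]
      exact mul_le_mul_of_nonneg_left this h.tau_nonneg)
  simpa [kpa] using this

/-! ### The covariance of two multiplicative local observables -/

/-- **Exponential clustering in the closed-vortex ensemble (cluster expansion).** In the KP regime,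
let `ψ₁, ψ₂` be multiplicative observables bounded by `1` and local on the plaquette sets
`B₁, B₂`, and suppose every cluster of connected polymers meeting `B₂` and touching `B₁` has
total size at least `D`. Then
`‖Z(ψ₁ψ₂)/Z(1) - Z(ψ₁)/Z(1) · Z(ψ₂)/Z(1)‖ ≤ 6 #B₁ e^{6 #B₁ + 2 #B₂} e^{-τ D}`:
by the expansion `Z(ψ)/Z(1) = exp ∑_{C meets B} dPhi(C)` the covariance is
`e^{A₁+A₂}(e^{R₁₂} - e^{R₁+R₂})` with `|Aᵢ| ≤ 2 #Bᵢ` (clusters meeting one set, estimate (4))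
and `|R| ≤ 2 #B₁ e^{-τ D}` (clusters meeting both, estimate (4) with `d = τ #·`).
[cite: KoteckyPreiss1986, Theorem p. 492, (2), (4), (5)] -/
theorem norm_closedCov_le (h : KPRegime d A φ ε τ) {ψ₁ ψ₂ : (Plaquette d L → A) → ℂ}
    {B₁ B₂ : Finset (Plaquette d L)} (hm₁ : IsMultObs ψ₁) (hm₂ : IsMultObs ψ₂)
    (hb₁ : ∀ η, ‖ψ₁ η‖ ≤ 1) (hb₂ : ∀ η, ‖ψ₂ η‖ ≤ 1) (hl₁ : IsLocalOn ψ₁ B₁) (hl₂ : IsLocalOn ψ₂ B₂)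
    {D : ℝ} (hD0 : 0 ≤ D)
    (hD : ∀ C ∈ (connSets d L).powerset, IsPolymerCluster (GeomInc CubeAdj) C → Meets C B₂ →
      KPTouches (GeomInc CubeAdj) C B₁ → D ≤ ∑ X ∈ C, (X.card : ℝ)) :
    ‖Zobs φ (fun η => ψ₁ η * ψ₂ η) / Zobs φ (fun _ : Plaquette d L → A => (1 : ℂ)) -
        (Zobs φ ψ₁ / Zobs φ (fun _ : Plaquette d L → A => (1 : ℂ))) * (Zobs φ ψ₂ / Zobs φ (fun _ : Plaquette d L → A => (1 : ℂ)))‖ ≤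
      6 * B₁.card * Real.exp (6 * B₁.card + 2 * B₂.card) * Real.exp (-(τ * D)) := by
  classical
  -- notation
  set PP := (connSets d L).powerset with hPP
  set ψ₁₂ : (Plaquette d L → A) → ℂ := fun η => ψ₁ η * ψ₂ η with hψ₁₂
  have hm₁₂ : IsMultObs ψ₁₂ := hm₁.mul hm₂
  have hb₁₂ : ∀ η, ‖ψ₁₂ η‖ ≤ 1 := fun η => by
    rw [hψ₁₂, norm_mul]; exact mul_le_one₀ (hb₁ η) (norm_nonneg _) (hb₂ η)
  have hone : ∀ η : Plaquette d L → A, ‖(fun _ : Plaquette d L → A => (1 : ℂ)) η‖ ≤ 1 :=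
    fun _ => by simp
  -- abbreviation for the truncated functionals
  set T := fun (ψ : (Plaquette d L → A) → ℂ) (C : Finset (Finset (Plaquette d L))) =>
    truncatedWeight (GeomInc CubeAdj) (act φ ψ) C with hT
  -- the expansions `Z(ψ)/Z(1) = exp (∑ dPhi ψ)`
  have hZ : ∀ {ψ : (Plaquette d L → A) → ℂ}, IsMultObs ψ → (∀ η, ‖ψ η‖ ≤ 1) →
      Zobs φ ψ = Complex.exp (∑ C ∈ PP, T ψ C) :=
    fun hm hb => h.Z_eq_exp_sum_truncatedWeight hm hb
  have hZ1 := hZ isMultObs_one hone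
  have hratio : ∀ {ψ : (Plaquette d L → A) → ℂ}, IsMultObs ψ → (∀ η, ‖ψ η‖ ≤ 1) →
      Zobs φ ψ / Zobs φ (fun _ : Plaquette d L → A => (1 : ℂ)) = Complex.exp (∑ C ∈ PP, dPhi φ ψ C) := by
    intro ψ hm hb
    rw [hZ hm hb, hZ1, ← Complex.exp_sub, ← Finset.sum_sub_distrib]
    rfl
  -- vanishing and agreement of the `dPhi` according to which set a family meets
  have hv₁ : ∀ C, ¬ Meets C B₁ → dPhi φ ψ₁ C = 0 := fun C hC => by
    rw [dPhi, truncatedWeight_eq_of_not_meets hl₁ hC, sub_self]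
  have hv₂ : ∀ C, ¬ Meets C B₂ → dPhi φ ψ₂ C = 0 := fun C hC => by
    rw [dPhi, truncatedWeight_eq_of_not_meets hl₂ hC, sub_self]
  have hv₁₂₀ : ∀ C, ¬ Meets C B₁ → ¬ Meets C B₂ → dPhi φ ψ₁₂ C = 0 := fun C h1 h2 => by
    have hno : ¬ Meets C (B₁ ∪ B₂) := fun ⟨X, hX, hne⟩ => by
      rw [Finset.inter_union_distrib_left, Finset.union_nonempty] at hne
      rcases hne with hne | hne
      · exact h1 ⟨X, hX, hne⟩
      · exact h2 ⟨X, hX, hne⟩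
    rw [dPhi, truncatedWeight_eq_of_not_meets (hl₁.mul hl₂) hno, sub_self]
  have hv₁₂₁ : ∀ C, ¬ Meets C B₂ → dPhi φ ψ₁₂ C = dPhi φ ψ₁ C := fun C hC => by
    rw [dPhi, dPhi, truncatedWeight_mul_eq_of_not_meets hl₂ hC]
  have hv₁₂₂ : ∀ C, ¬ Meets C B₁ → dPhi φ ψ₁₂ C = dPhi φ ψ₂ C := fun C hC => by
    have hcomm : ψ₁₂ = fun η => ψ₂ η * ψ₁ η := by funext η; rw [hψ₁₂]; ring
    rw [hcomm, dPhi, dPhi, truncatedWeight_mul_eq_of_not_meets hl₁ hC]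
  -- the exponents, as indicator sums
  set A₁ := ∑ C ∈ PP, (if Meets C B₁ ∧ ¬ Meets C B₂ then dPhi φ ψ₁ C else 0) with hA₁
  set A₂ := ∑ C ∈ PP, (if Meets C B₂ ∧ ¬ Meets C B₁ then dPhi φ ψ₂ C else 0) with hA₂
  set R₁ := ∑ C ∈ PP, (if Meets C B₁ ∧ Meets C B₂ then dPhi φ ψ₁ C else 0) with hR₁
  set R₂ := ∑ C ∈ PP, (if Meets C B₁ ∧ Meets C B₂ then dPhi φ ψ₂ C else 0) with hR₂
  set R₁₂ := ∑ C ∈ PP, (if Meets C B₁ ∧ Meets C B₂ then dPhi φ ψ₁₂ C else 0) with hR₁₂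
  have hS₁ : ∑ C ∈ PP, dPhi φ ψ₁ C = A₁ + R₁ := by
    rw [hA₁, hR₁, ← Finset.sum_add_distrib]
    refine Finset.sum_congr rfl fun C _ => ?_
    by_cases h1 : Meets C B₁ <;> by_cases h2 : Meets C B₂ <;> simp [h1, h2, hv₁]
  have hS₂ : ∑ C ∈ PP, dPhi φ ψ₂ C = A₂ + R₂ := by
    rw [hA₂, hR₂, ← Finset.sum_add_distrib]
    refine Finset.sum_congr rfl fun C _ => ?_
    by_cases h1 : Meets C B₁ <;> by_cases h2 : Meets C B₂ <;> simp [h1, h2, hv₂]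
  have hS₁₂ : ∑ C ∈ PP, dPhi φ ψ₁₂ C = A₁ + A₂ + R₁₂ := by
    rw [hA₁, hA₂, hR₁₂, ← Finset.sum_add_distrib, ← Finset.sum_add_distrib]
    refine Finset.sum_congr rfl fun C _ => ?_
    by_cases h1 : Meets C B₁ <;> by_cases h2 : Meets C B₂ <;>
      simp [h1, h2, hv₁₂₀, hv₁₂₁, hv₁₂₂]
  -- bounds for clusters meeting one of the sets
  have hmeet : ∀ (ψ : (Plaquette d L → A) → ℂ), (∀ η, ‖ψ η‖ ≤ 1) → ∀ (B : Finset (Plaquette d L)),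
      ∑ C ∈ PP, (if Meets C B then ‖T ψ C‖ else 0) ≤ B.card := by
    intro ψ hb B
    rw [← Finset.sum_filter]
    exact h.sum_meets_norm_le hb PP B
  -- bound for clusters meeting both sets: only clusters count, and they are large
  have hboth : ∀ (ψ : (Plaquette d L → A) → ℂ), (∀ η, ‖ψ η‖ ≤ 1) →
      ∑ C ∈ PP, (if Meets C B₁ ∧ Meets C B₂ then ‖T ψ C‖ else 0) ≤ Real.exp (-(τ * D)) * B₁.card := by
    intro ψ hb
    set CC := PP.filter fun C => IsPolymerCluster (GeomInc CubeAdj) C ∧ Meets C B₂ with hCC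
    have hfar := h.sum_touches_norm_le_exp_neg hb CC B₁ (D := D) (fun C hC ht => by
      simp only [hCC, Finset.mem_filter] at hC
      exact hD C hC.1 hC.2.1 hC.2.2 ht)
    refine le_trans ?_ hfar
    -- compare term by term after inserting the cluster condition
    calc ∑ C ∈ PP, (if Meets C B₁ ∧ Meets C B₂ then ‖T ψ C‖ else 0)
        = ∑ C ∈ PP, (if IsPolymerCluster (GeomInc CubeAdj) C ∧ Meets C B₂ then
            (if KPTouches (GeomInc CubeAdj) C B₁ then
              (if Meets C B₁ ∧ Meets C B₂ then ‖T ψ C‖ else 0) else 0) else 0) := by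
          refine Finset.sum_congr rfl fun C hC => ?_
          by_cases hcl : IsPolymerCluster (GeomInc CubeAdj) C
          · by_cases h1 : Meets C B₁ <;> by_cases h2 : Meets C B₂ <;>
              simp [hcl, h1, h2, kpTouches_of_meets]
          · have hT0 : T ψ C = 0 := by
              simp only [hT]
              exact Literature.Probability.LatticeModels.truncatedWeight_eq_zero_of_kp (h.isKPVolume hb)
                (Finset.mem_powerset.1 hC) hcl
            simp [hcl, hT0]
      _ = ∑ C ∈ CC.filter (fun C => KPTouches (GeomInc CubeAdj) C B₁),
            (if Meets C B₁ ∧ Meets C B₂ then ‖T ψ C‖ else 0) := by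
          rw [Finset.sum_filter, Finset.sum_filter]
      _ ≤ ∑ C ∈ CC.filter (fun C => KPTouches (GeomInc CubeAdj) C B₁), ‖T ψ C‖ :=
          Finset.sum_le_sum fun C _ => by split_ifs <;> simp
  -- norms of the exponents
  have hnA : ∀ (ψ : (Plaquette d L → A) → ℂ), (∀ η, ‖ψ η‖ ≤ 1) → ∀ (p : Finset (Finset (Plaquette d L)) → Prop)
      [DecidablePred p], (∀ C, p C → Meets C B₁) →
      ‖∑ C ∈ PP, (if p C then dPhi φ ψ C else 0)‖ ≤ 2 * B₁.card := by
    intro ψ hb p _ hp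
    refine (norm_sum_ite_le PP p _).trans ?_
    have h1 := hmeet ψ hb B₁
    have h2 := hmeet (fun _ => 1) hone B₁
    calc ∑ C ∈ PP, (if p C then ‖dPhi φ ψ C‖ else 0)
        ≤ ∑ C ∈ PP, ((if Meets C B₁ then ‖T ψ C‖ else 0) + (if Meets C B₁ then ‖T (fun _ => 1) C‖ else 0)) :=
          Finset.sum_le_sum fun C _ => by
            by_cases hpC : p C
            · have hm := hp C hpC
              simp only [hpC, hm, if_true]
              exact norm_dPhi_le φ ψ C
            · simp only [hpC, if_false]
              positivity
      _ ≤ 2 * B₁.card := by rw [Finset.sum_add_distrib]; linarith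
  have hnA' : ∀ (ψ : (Plaquette d L → A) → ℂ), (∀ η, ‖ψ η‖ ≤ 1) → ∀ (p : Finset (Finset (Plaquette d L)) → Prop)
      [DecidablePred p], (∀ C, p C → Meets C B₂) →
      ‖∑ C ∈ PP, (if p C then dPhi φ ψ C else 0)‖ ≤ 2 * B₂.card := by
    intro ψ hb p _ hp
    refine (norm_sum_ite_le PP p _).trans ?_
    have h1 := hmeet ψ hb B₂
    have h2 := hmeet (fun _ => 1) hone B₂
    calc ∑ C ∈ PP, (if p C then ‖dPhi φ ψ C‖ else 0)
        ≤ ∑ C ∈ PP, ((if Meets C B₂ then ‖T ψ C‖ else 0) + (if Meets C B₂ then ‖T (fun _ => 1) C‖ else 0)) :=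
          Finset.sum_le_sum fun C _ => by
            by_cases hpC : p C
            · have hm := hp C hpC
              simp only [hpC, hm, if_true]
              exact norm_dPhi_le φ ψ C
            · simp only [hpC, if_false]
              positivity
      _ ≤ 2 * B₂.card := by rw [Finset.sum_add_distrib]; linarith
  have hnR : ∀ (ψ : (Plaquette d L → A) → ℂ), (∀ η, ‖ψ η‖ ≤ 1) →
      ‖∑ C ∈ PP, (if Meets C B₁ ∧ Meets C B₂ then dPhi φ ψ C else 0)‖ ≤ 2 * (Real.exp (-(τ * D)) * B₁.card) := by
    intro ψ hb
    refine (norm_sum_ite_le PP _ _).trans ?_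
    have h1 := hboth ψ hb
    have h2 := hboth (fun _ => 1) hone
    calc ∑ C ∈ PP, (if Meets C B₁ ∧ Meets C B₂ then ‖dPhi φ ψ C‖ else 0)
        ≤ ∑ C ∈ PP, ((if Meets C B₁ ∧ Meets C B₂ then ‖T ψ C‖ else 0) +
            (if Meets C B₁ ∧ Meets C B₂ then ‖T (fun _ => 1) C‖ else 0)) :=
          Finset.sum_le_sum fun C _ => by
            split_ifs with hc
            · exact norm_dPhi_le φ ψ C
            · simp
      _ ≤ 2 * (Real.exp (-(τ * D)) * B₁.card) := by rw [Finset.sum_add_distrib]; linarith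
  have hA₁b : ‖A₁‖ ≤ 2 * B₁.card := hnA ψ₁ hb₁ _ (fun C hC => hC.1)
  have hA₂b : ‖A₂‖ ≤ 2 * B₂.card := hnA' ψ₂ hb₂ _ (fun C hC => hC.1)
  have hR₁b : ‖R₁‖ ≤ 2 * (Real.exp (-(τ * D)) * B₁.card) := hnR ψ₁ hb₁
  have hR₂b : ‖R₂‖ ≤ 2 * (Real.exp (-(τ * D)) * B₁.card) := hnR ψ₂ hb₂
  have hR₁₂b : ‖R₁₂‖ ≤ 2 * (Real.exp (-(τ * D)) * B₁.card) := hnR ψ₁₂ hb₁₂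
  -- assemble: `Cov = e^{A₁+A₂} (e^{R₁₂} - e^{R₁+R₂})`
  have hcov : Zobs φ ψ₁₂ / Zobs φ (fun _ : Plaquette d L → A => (1 : ℂ)) -
      (Zobs φ ψ₁ / Zobs φ (fun _ : Plaquette d L → A => (1 : ℂ))) *
        (Zobs φ ψ₂ / Zobs φ (fun _ : Plaquette d L → A => (1 : ℂ))) =
      Complex.exp (A₁ + A₂) * (Complex.exp R₁₂ - Complex.exp (R₁ + R₂)) := by
    rw [hratio hm₁₂ hb₁₂, hratio hm₁ hb₁, hratio hm₂ hb₂, hS₁, hS₂, hS₁₂, mul_sub, ← Complex.exp_add,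
      ← Complex.exp_add, ← Complex.exp_add]
    congr 2
    all_goals ring
  rw [hcov, norm_mul, Complex.norm_exp]
  -- numeric bounds
  set e : ℝ := Real.exp (-(τ * D)) * B₁.card with he
  have hexp1 : Real.exp (-(τ * D)) ≤ 1 := by
    rw [Real.exp_le_one_iff]; nlinarith [h.tau_nonneg, hD0]
  have hB₁0 : (0 : ℝ) ≤ B₁.card := Nat.cast_nonneg _
  have he0 : 0 ≤ e := mul_nonneg (Real.exp_nonneg _) hB₁0
  have heB : e ≤ B₁.card := by rw [he]; exact mul_le_of_le_one_left hB₁0 hexp1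
  have hre : (A₁ + A₂).re ≤ 2 * B₁.card + 2 * B₂.card := by
    have := Complex.re_le_norm (A₁ + A₂)
    have := norm_add_le A₁ A₂
    linarith
  have hdiff : ‖Complex.exp R₁₂ - Complex.exp (R₁ + R₂)‖ ≤ 6 * e * Real.exp (4 * B₁.card) := by
    have h1 : ‖Complex.exp R₁₂ - 1‖ ≤ 2 * e * Real.exp (4 * B₁.card) := by
      refine (norm_exp_sub_one_le_mul_exp R₁₂).trans ?_
      refine mul_le_mul hR₁₂b (Real.exp_le_exp.2 ?_) (Real.exp_nonneg _) (by positivity)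
      linarith
    have h2 : ‖Complex.exp (R₁ + R₂) - 1‖ ≤ 4 * e * Real.exp (4 * B₁.card) := by
      refine (norm_exp_sub_one_le_mul_exp (R₁ + R₂)).trans ?_
      have hn : ‖R₁ + R₂‖ ≤ 4 * e := (norm_add_le _ _).trans (by linarith)
      refine mul_le_mul hn (Real.exp_le_exp.2 ?_) (Real.exp_nonneg _) (by positivity)
      linarith
    calc ‖Complex.exp R₁₂ - Complex.exp (R₁ + R₂)‖
        = ‖(Complex.exp R₁₂ - 1) - (Complex.exp (R₁ + R₂) - 1)‖ := by rw [sub_sub_sub_cancel_right]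
      _ ≤ ‖Complex.exp R₁₂ - 1‖ + ‖Complex.exp (R₁ + R₂) - 1‖ := norm_sub_le _ _
      _ ≤ 6 * e * Real.exp (4 * B₁.card) := by linarith
  calc Real.exp (A₁ + A₂).re * ‖Complex.exp R₁₂ - Complex.exp (R₁ + R₂)‖
      ≤ Real.exp (2 * B₁.card + 2 * B₂.card) * (6 * e * Real.exp (4 * B₁.card)) :=
        mul_le_mul (Real.exp_le_exp.2 hre) hdiff (norm_nonneg _) (Real.exp_nonneg _)
    _ = 6 * B₁.card * Real.exp (6 * B₁.card + 2 * B₂.card) * Real.exp (-(τ * D)) := by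
        have hexp : Real.exp (6 * (B₁.card : ℝ) + 2 * B₂.card) =
            Real.exp (2 * B₁.card + 2 * B₂.card) * Real.exp (4 * B₁.card) := by
          rw [← Real.exp_add]; ring_nf
        rw [hexp, he]; ring

end KPRegime

/-! ### Geometry: clusters meeting two far-apart plaquette sets are large -/

/-- `(x + 1).val = (x.val + 1) % L` in `ℤ/Lℤ`. [folklore] -/
theorem val_add_one (x : ZMod L) : (x + 1).val = (x.val + 1) % L := by
  rw [ZMod.val_add, ZMod.val_one_eq_one_mod, Nat.add_mod_mod]

/-- The circular distance of two residues mod `L`: `min (u, L - u)` for `u = (z - c).val`. [folklore] -/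
def cdist (z c : ZMod L) : ℕ := min (z - c).val (L - (z - c).val)

/-- **One step changes the circular distance by at most one.** [folklore] -/
theorem cdist_succ (z c : ZMod L) : cdist (z + 1) c ≤ cdist z c + 1 ∧ cdist z c ≤ cdist (z + 1) c + 1 := by
  have hu : (z - c).val < L := ZMod.val_lt _
  have hval : (z + 1 - c).val = ((z - c).val + 1) % L := by
    rw [show z + 1 - c = (z - c) + 1 by ring, val_add_one]
  unfold cdist
  rw [hval]
  rcases Nat.lt_or_ge ((z - c).val + 1) L with h | h
  · rw [Nat.mod_eq_of_lt h]; omega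
  · have hEq : (z - c).val + 1 = L := by omega
    rw [hEq, Nat.mod_self]; omega

/-- The level of a plaquette: the circular distance of the `m`-th coordinate of its base point
from a reference residue `c`. [folklore] -/
def torusLevel (m : Fin d) (c : ZMod L) (p : Plaquette d L) : ℕ := cdist (p.1 m) c

/-- Cube-adjacent plaquettes have levels differing by at most one. [folklore] -/
theorem torusLevel_le_of_cubeAdj (m : Fin d) (c : ZMod L) {p q : Plaquette d L} (h : CubeAdj p q) :
    torusLevel m c q ≤ torusLevel m c p + 1 ∧ torusLevel m c p ≤ torusLevel m c q + 1 := by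
  unfold torusLevel
  rcases h.coord_sub m with h0 | h1 | h2
  · rw [sub_eq_zero.1 h0]; omega
  · have hq : q.1 m = p.1 m + 1 := by rw [← h1]; ring
    rw [hq]; exact cdist_succ _ _
  · have hp : p.1 m = q.1 m + 1 := by
      have : q.1 m = p.1 m + -1 := by rw [← h2]; ring
      rw [this]; ring
    rw [hp]; exact ⟨(cdist_succ _ _).2, (cdist_succ _ _).1⟩

omit [NeZero L] in
/-- **Supports of clusters of connected polymers are connected** (geometric incompatibility):
if `C` is a cluster for `GeomInc CubeAdj` and every member is cube-connected, any two plaquettes of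
`clusterSupp C` are joined by a chain of cube-adjacent plaquettes inside `clusterSupp C`
(cf. `PolymerPressure.reflTransGen_clusterSupp_of_isPolymerCluster` for subset polymers). [folklore] -/
theorem reflTransGen_clusterSupp_of_isPolymerCluster {C : Finset (Finset (Plaquette d L))}
    (hCl : IsPolymerCluster (GeomInc CubeAdj) C) (hconn : ∀ X ∈ C, IsRConnected CubeAdj X)
    {v w : Plaquette d L} (hv : v ∈ clusterSupp C) (hw : w ∈ clusterSupp C) :
    Relation.ReflTransGen (fun a b => CubeAdj a b ∧ a ∈ clusterSupp C ∧ b ∈ clusterSupp C) v w := by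
  classical
  set R : Plaquette d L → Prop := fun u =>
    Relation.ReflTransGen (fun a b => CubeAdj a b ∧ a ∈ clusterSupp C ∧ b ∈ clusterSupp C) v u with hR
  -- a connected member meeting the reachable set is entirely reachable
  have hlift : ∀ X ∈ C, ∀ u ∈ X, ∀ u' ∈ X, R u → R u' := by
    intro X hX u hu u' hu' hRu
    have hXs : X ⊆ clusterSupp C := Literature.Probability.LatticeModels.subset_clusterSupp hX
    have hpath := (hconn X hX).2 u hu u' hu'
    have hmono := Relation.ReflTransGen.mono (r := fun a b => CubeAdj a b ∧ a ∈ X ∧ b ∈ X)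
      (p := fun a b => CubeAdj a b ∧ a ∈ clusterSupp C ∧ b ∈ clusterSupp C)
      fun a b hab => ⟨hab.1, hXs hab.2.1, hXs hab.2.2⟩
    exact hRu.trans (hmono u u' hpath)
  by_contra hvw
  set C₁ : Finset (Finset (Plaquette d L)) := C.filter fun X => ∀ u ∈ X, R u with hC₁
  obtain ⟨X₀, hX₀, hvX₀⟩ := Literature.Probability.LatticeModels.mem_clusterSupp.1 hv
  obtain ⟨X₁, hX₁, hwX₁⟩ := Literature.Probability.LatticeModels.mem_clusterSupp.1 hw
  have hX₀C₁ : X₀ ∈ C₁ := Finset.mem_filter.2 ⟨hX₀, fun u hu => hlift X₀ hX₀ v hvX₀ u hu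
    Relation.ReflTransGen.refl⟩
  have hX₁C₁ : X₁ ∉ C₁ := fun h1 => hvw ((Finset.mem_filter.1 h1).2 w hwX₁)
  obtain ⟨γ₁, hγ₁, γ₂, hγ₂, hinc⟩ := hCl C₁ (Finset.filter_subset _ _) ⟨X₀, hX₀C₁⟩
    ⟨X₁, Finset.mem_sdiff.2 ⟨hX₁, hX₁C₁⟩⟩
  obtain ⟨hγ₂C, hγ₂C₁⟩ := Finset.mem_sdiff.1 hγ₂
  have hγ₁R : ∀ u ∈ γ₁, R u := (Finset.mem_filter.1 hγ₁).2
  rcases hinc with hEq | ⟨a, ha, b, hb, hab⟩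
  · exact hγ₂C₁ (hEq ▸ hγ₁)
  · have hRb : R b := by
      rcases hab with rfl | hab
      · exact hγ₁R a ha
      · exact (hγ₁R a ha).tail ⟨hab,
          Literature.Probability.LatticeModels.subset_clusterSupp (Finset.mem_filter.1 hγ₁).1 ha,
          Literature.Probability.LatticeModels.subset_clusterSupp hγ₂C hb⟩
    exact hγ₂C₁ (Finset.mem_filter.2 ⟨hγ₂C, fun u' hu' => hlift γ₂ hγ₂C b hb u' hu' hRb⟩)

omit [NeZero L] in
/-- **Discrete intermediate value theorem**: along a chain of cube-adjacent plaquettes inside `K`,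
a `1`-Lipschitz level function attains every value between the levels of the endpoints. [folklore] -/
theorem exists_level_eq_of_reflTransGen {K : Finset (Plaquette d L)} (lev : Plaquette d L → ℕ)
    (hlip : ∀ a b : Plaquette d L, CubeAdj a b → lev b ≤ lev a + 1 ∧ lev a ≤ lev b + 1)
    {v w : Plaquette d L} (hv : v ∈ K)
    (h : Relation.ReflTransGen (fun a b => CubeAdj a b ∧ a ∈ K ∧ b ∈ K) v w) :
    ∀ n : ℕ, min (lev v) (lev w) ≤ n → n ≤ max (lev v) (lev w) → ∃ p ∈ K, lev p = n := by
  induction h with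
  | refl => intro n h1 h2; exact ⟨v, hv, by omega⟩
  | @tail b c _ hbc ih =>
    intro n h1 h2
    by_cases hold : min (lev v) (lev b) ≤ n ∧ n ≤ max (lev v) (lev b)
    · exact ih n hold.1 hold.2
    · have := hlip b c hbc.1
      exact ⟨c, hbc.2.2, by omega⟩

omit [NeZero L] in
/-- A finite set of plaquettes, cube-chained from `v` to `w` inside itself, has at least
`|lev w - lev v| + 1` elements. [folklore] -/
theorem level_span_le_card {K : Finset (Plaquette d L)} (lev : Plaquette d L → ℕ)
    (hlip : ∀ a b : Plaquette d L, CubeAdj a b → lev b ≤ lev a + 1 ∧ lev a ≤ lev b + 1)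
    {v w : Plaquette d L} (hv : v ∈ K)
    (h : Relation.ReflTransGen (fun a b => CubeAdj a b ∧ a ∈ K ∧ b ∈ K) v w) :
    max (lev v) (lev w) + 1 ≤ K.card + min (lev v) (lev w) := by
  classical
  have hsub : Finset.Icc (min (lev v) (lev w)) (max (lev v) (lev w)) ⊆ K.image lev := by
    intro n hn
    rw [Finset.mem_Icc] at hn
    obtain ⟨p, hp, hpn⟩ := exists_level_eq_of_reflTransGen lev hlip hv h n hn.1 hn.2
    exact Finset.mem_image.2 ⟨p, hp, hpn⟩
  have hcard := (Finset.card_le_card hsub).trans Finset.card_image_le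
  rw [Nat.card_Icc] at hcard
  omega

/-- **A cluster meeting two plaquette sets separated along an axis is large.** Let `C` be a cluster
(for `GeomInc CubeAdj`) of cube-connected plaquette sets which meets `B₂` and touches the polymer
`B₁`; if along the axis `m` all plaquettes of `B₁` have level `≤ u` and all plaquettes of `B₂`
have level `≥ v` (levels = circular distance of the `m`-th base coordinate from `c`), then
`∑_{X ∈ C} #X ≥ v - u - 1`. (The support of `C` is cube-connected and levels are `1`-Lipschitz.)
[folklore] -/
theorem le_sum_card_of_cluster_meets {C : Finset (Finset (Plaquette d L))}
    (hC : C ∈ (connSets d L).powerset) (hCl : IsPolymerCluster (GeomInc CubeAdj) C)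
    {B₁ B₂ : Finset (Plaquette d L)} (m : Fin d) (c : ZMod L) {u v : ℕ}
    (hB₁ : ∀ b ∈ B₁, torusLevel m c b ≤ u) (hB₂ : ∀ b ∈ B₂, v ≤ torusLevel m c b)
    (h2 : Meets C B₂) (h1 : KPTouches (GeomInc CubeAdj) C B₁) :
    ((v : ℝ) - u - 1) ≤ ∑ X ∈ C, (X.card : ℝ) := by
  classical
  have hconn : ∀ X ∈ C, IsRConnected CubeAdj X := fun X hX =>
    mem_connSets.1 (Finset.mem_powerset.1 hC hX)
  -- a plaquette of the support near `B₁`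
  obtain ⟨x₁, hx₁K, hx₁⟩ : ∃ x₁ ∈ clusterSupp C, torusLevel m c x₁ ≤ u + 1 := by
    obtain ⟨X₁, hX₁, hinc⟩ := h1
    rcases hinc with hEq | ⟨a, ha, b, hb, hab⟩
    · obtain ⟨p, hp⟩ := (hconn X₁ hX₁).1
      refine ⟨p, Literature.Probability.LatticeModels.subset_clusterSupp hX₁ hp, ?_⟩
      have := hB₁ p (hEq ▸ hp)
      omega
    · refine ⟨a, Literature.Probability.LatticeModels.subset_clusterSupp hX₁ ha, ?_⟩
      rcases hab with rfl | hab
      · have := hB₁ a hb; omega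
      · have := (torusLevel_le_of_cubeAdj m c hab).2
        have := hB₁ b hb
        omega
  -- a plaquette of the support in `B₂`
  obtain ⟨x₂, hx₂K, hx₂⟩ : ∃ x₂ ∈ clusterSupp C, v ≤ torusLevel m c x₂ := by
    obtain ⟨X₂, hX₂, q, hq⟩ := h2
    rw [Finset.mem_inter] at hq
    exact ⟨q, Literature.Probability.LatticeModels.subset_clusterSupp hX₂ hq.1, hB₂ q hq.2⟩
  have hchain := reflTransGen_clusterSupp_of_isPolymerCluster hCl hconn hx₁K hx₂K
  have hspan := level_span_le_card (torusLevel m c) (fun a b hab => torusLevel_le_of_cubeAdj m c hab)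
    hx₁K hchain
  have hKcard := Literature.Probability.LatticeModels.card_clusterSupp_le_sum_card C
  have hnat : v ≤ (∑ X ∈ C, X.card) + u := by
    have h1 := le_max_right (torusLevel m c x₁) (torusLevel m c x₂)
    have h2 := min_le_left (torusLevel m c x₁) (torusLevel m c x₂)
    omega
  have hcast : ((∑ X ∈ C, X.card : ℕ) : ℝ) = ∑ X ∈ C, (X.card : ℝ) := by push_cast; rfl
  have : (v : ℝ) ≤ (∑ X ∈ C, (X.card : ℝ)) + u := by
    rw [← hcast]; exact_mod_cast hnat
  linarith

end LatticeForm

end Literature.MathematicalPhysics.QuantumFieldTheory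

end
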